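import Mathlib
import HarnessLib
import Summits.AtomisticToContinuum.Crystallization.Theorems.PalmUnimodularRigidityBenjaminiSchrammLimitCampbell
import Summits.AtomisticToContinuum.Crystallization.Theorems.FrustratedLawDichotomyAperiodicFrustratedLawGapErgodicPullback
import Summits.AtomisticToContinuum.Crystallization.Theorems.FrustratedLawDichotomyAperiodicFrustratedLawGapErgodicCampbell
import Summits.AtomisticToContinuum.Crystallization.Theorems.FrustratedLawDichotomyAperiodicFrustratedLawGapErgodicRestrict
import Summits.AtomisticToContinuum.Crystallization.Theorems.FrustratedLawDichotomyAperiodicFrustratedLawGapErgodicSigma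
import Summits.AtomisticToContinuum.Crystallization.Theorems.FrustratedLawDichotomyAperiodicFrustratedLawGapErgodicCondKernel
import Summits.AtomisticToContinuum.Crystallization.Theorems.FrustratedLawDichotomyAperiodicFrustratedLawGapErgodicTransfer

/-!
# Ergodic reduction for the crux `AperiodicFrustratedLawGap` — assembly of the decomposition modulo a.e. ergodicity

Route `FrustratedLawDichotomy`, crux `AperiodicFrustratedLawGap` (item `stmt-AtomisticToContinuum-27623`),
registered stub `stub_ergodicReduction` (skeleton `dd3251ad731e`).  Assembly (steps D0–D4, D6) of the plan
recorded in `…ErgodicReduction`: from the pull-back to the configuration space (`…ErgodicPullback`), the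
Mecke ⇔ Campbell-invariance dictionary (`…ErgodicCampbell`,
`BenjaminiSchrammLimit.isPointStationaryLaw_map_toMeasure`), restriction to invariant events
(`…ErgodicRestrict`), the invariant σ-algebra (`…ErgodicSigma`) and the a.e. Campbell-invariance of the
conditional laws (`…ErgodicCondKernel`), we obtain the KERNEL-FORM ERGODIC DECOMPOSITION of every
point-stationary hard-core law — the hypothesis `hdec` of
`…ErgodicTransfer.ergodicReduction_of_kernelDecomposition` — from the single remaining input (step D5):

* `hErg` — **a.e. ergodicity of the conditional laws**: for every probability law `Q` on rooted `δ`-hard-core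
  configurations with Campbell measure invariant under re-rooting and for the σ-algebra `𝓘` of measurable
  re-rooting-invariant sets, `Q`-almost every conditional law `condExpKernel Q 𝓘 ω` is trivial on every
  measurable re-rooting-invariant set.  (Farrell–Varadarajan "ergodicity by conditioning"; Kallenberg,
  *Foundations of Modern Probability* (3rd ed.) Prop. 10.24 — there via the multivariate pointwise ergodic
  theorem; for point-stationary laws a mean ergodic theorem for the lazy symmetric re-rooting Markov operator
  suffices, see the census of the item.)

* `kernelDecomposition_of_aeErgodic : hErg → hdec`: take `Q = P.comap ι`, `F ω = (condExpKernel Q 𝓘 ω).map ι`;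
* `ergodicReduction_of_aeErgodic : hLB → hErg → S_ergodicReduction` — the registered stub statement VERBATIM
  from the proved item-9229 lower bound and the single open input `hErg`.

`[folklore]`.
-/

noncomputable section

namespace Summit.AtomisticToContinuum.Crystallization.Theorems.FrustratedLawDichotomyErgodicReduction

open MeasureTheory Set Filter ProbabilityTheory
open scoped ENNReal Classical
open Literature.Probability.Process (IsRootedHardCore IsPointStationaryLaw LocalConfig)
open Literature.Probability.Process.LocalConfig (RootedHardCoreConfig toMeasure_def measurable_toMeasure)
open Summit.AtomisticToContinuum.Crystallization.Theorems.BenjaminiSchrammLimit (measurableEmbedding_toMeasure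
  isSFiniteKernel_toMeasure isPointStationaryLaw_map_toMeasure)
open Summit.AtomisticToContinuum.Crystallization.Theses.PalmUnimodularRigidity (UnimodularEnergyLowerBound)

/-- **The kernel-form ergodic decomposition from a.e. ergodicity of the conditional laws.**  For every
`δ > 0` and every point-stationary probability law `P` on `Measure ℝ³` carried by rooted `δ`-hard-core
configurations: with `Q = P.comap ι` on the compact configuration space, `𝓘` the σ-algebra of measurable
re-rooting-invariant sets and `F ω = (condExpKernel Q 𝓘 ω).map ι`, one has `Q.bind F = P`, `F`
measurable, and for `Q`-a.e. `ω` the law `F ω` is a point-stationary probability law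
(`ae_map_reroot_compProd_condExpKernel` + `isPointStationaryLaw_map_toMeasure`); if moreover the
conditional laws are a.e. trivial on `𝓘` (hypothesis `hErg`, the remaining step D5), then `F ω` is a.e.
trivial on the measurable sets of measures invariant under re-rooting at atoms (`ergodic_map_toMeasure`).
[folklore] -/
theorem kernelDecomposition_of_aeErgodic
    (hErg : ∀ δ : ℝ, ∀ hδ : 0 < δ, ∀ (Q : MeasureTheory.Measure (Literature.Probability.Process.LocalConfig.RootedHardCoreConfig (EuclideanSpace ℝ (Fin 3)) δ)) [MeasureTheory.IsProbabilityMeasure Q], haveI : Fact (0 < δ) := ⟨hδ⟩; (haveI := Summit.AtomisticToContinuum.Crystallization.Theorems.BenjaminiSchrammLimit.isSFiniteKernel_toMeasure (E := EuclideanSpace ℝ (Fin 3)) (δ := δ); (Q ⊗ₘ (⟨fun S : Literature.Probability.Process.LocalConfig.RootedHardCoreConfig (EuclideanSpace ℝ (Fin 3)) δ => (S.1 : Literature.Probability.Process.LocalConfig (EuclideanSpace ℝ (Fin 3))).toMeasure, Literature.Probability.Process.LocalConfig.measurable_toMeasure (Fact.out : 0 < δ)⟩ : ProbabilityTheory.Kernel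 (Literature.Probability.Process.LocalConfig.RootedHardCoreConfig (EuclideanSpace ℝ (Fin 3)) δ) (EuclideanSpace ℝ (Fin 3)))).map (fun p : Literature.Probability.Process.LocalConfig.RootedHardCoreConfig (EuclideanSpace ℝ (Fin 3)) δ × EuclideanSpace ℝ (Fin 3) => ((if h : p.2 ∈ ((p.1.1 : Literature.Probability.Process.LocalConfig (EuclideanSpace ℝ (Fin 3))) : Set (EuclideanSpace ℝ (Fin 3))) then p.1.reroot p.2 h else p.1 : Literature.Probability.Process.LocalConfig.RootedHardCoreConfig (EuclideanSpace ℝ (Fin 3)) δ), -p.2)) = Q ⊗ₘ (⟨fun S : Literature.Probability.Process.LocalConfig.RootedHardCoreConfig (EuclideanSpace ℝ (Fin 3)) δ => (S.1 : Literature.Probability.Process.LocalConfig (EuclideanSpace ℝ (Fin 3))).toMeasure, Literature.Probability.Process.LocalConfig.measurable_toMeasure (Fact.out : 0 < δ)⟩ : ProbabilityTheory.Kernel (Literature.Probability.Process.LocalConfig.RootedHardCoreConfig (EuclideanSpace ℝ (Fin 3)) δ) (EuclideanSpace ℝ (Fin 3)))) → ∀ 𝓘 : {m : MeasurableSpace (Literature.Probability.Process.LocalConfig.RootedHardCoreConfig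 (EuclideanSpace ℝ (Fin 3)) δ) // m ≤ (Subtype.instMeasurableSpace : MeasurableSpace (Literature.Probability.Process.LocalConfig.RootedHardCoreConfig (EuclideanSpace ℝ (Fin 3)) δ))}, (∀ B : Set (Literature.Probability.Process.LocalConfig.RootedHardCoreConfig (EuclideanSpace ℝ (Fin 3)) δ), MeasurableSet[𝓘.1] B ↔ (MeasurableSet B ∧ (∀ (S : Literature.Probability.Process.LocalConfig.RootedHardCoreConfig (EuclideanSpace ℝ (Fin 3)) δ) (y : EuclideanSpace ℝ (Fin 3)) (hy : y ∈ ((S.1 : Literature.Probability.Process.LocalConfig (EuclideanSpace ℝ (Fin 3))) : Set (EuclideanSpace ℝ (Fin 3)))), S ∈ B ↔ S.reroot y hy ∈ B))) → ∀ᵐ ω ∂Q, ∀ B : Set (Literature.Probability.Process.LocalConfig.RootedHardCoreConfig (EuclideanSpace ℝ (Fin 3)) δ), MeasurableSet B → (∀ (S : Literature.Probability.Process.LocalConfig.RootedHardCoreConfig (EuclideanSpace ℝ (Fin 3)) δ) (y : EuclideanSpace ℝ (Fin 3)) (hy : y ∈ ((S.1 : Literature.Probability.Process.LocalConfig (EuclideanSpace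 ℝ (Fin 3))) : Set (EuclideanSpace ℝ (Fin 3)))), S ∈ B ↔ S.reroot y hy ∈ B) → ProbabilityTheory.condExpKernel Q 𝓘.1 ω B = 0 ∨ ProbabilityTheory.condExpKernel Q 𝓘.1 ω Bᶜ = 0) :
    ∀ δ : ℝ, 0 < δ → ∀ P : MeasureTheory.Measure (MeasureTheory.Measure (EuclideanSpace ℝ (Fin 3))), MeasureTheory.IsProbabilityMeasure P → (∀ᵐ μ ∂P, Literature.Probability.Process.IsRootedHardCore δ μ) → Literature.Probability.Process.IsPointStationaryLaw P → ∃ Q : MeasureTheory.Measure (Literature.Probability.Process.LocalConfig.RootedHardCoreConfig (EuclideanSpace ℝ (Fin 3)) δ), MeasureTheory.IsProbabilityMeasure Q ∧ ∃ F : Literature.Probability.Process.LocalConfig.RootedHardCoreConfig (EuclideanSpace ℝ (Fin 3)) δ → MeasureTheory.Measure (MeasureTheory.Measure (EuclideanSpace ℝ (Fin 3))), Measurable F ∧ Q.bind F = P ∧ ∀ᵐ ω ∂Q, MeasureTheory.IsProbabilityMeasure (F ω) ∧ Literature.Probability.Process.IsPointStationaryLaw (F ω) ∧ (∀ A : Set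 (MeasureTheory.Measure (EuclideanSpace ℝ (Fin 3))), MeasurableSet A → (∀ μ : MeasureTheory.Measure (EuclideanSpace ℝ (Fin 3)), ∀ p : EuclideanSpace ℝ (Fin 3), μ {p} ≠ 0 → (μ ∈ A ↔ MeasureTheory.Measure.map (fun z : EuclideanSpace ℝ (Fin 3) => z - p) μ ∈ A)) → F ω A = 0 ∨ F ω Aᶜ = 0) := by
  intro δ hδ P hP hcore hstat
  haveI : Fact (0 < δ) := ⟨hδ⟩
  haveI := hP
  haveI := isSFiniteKernel_toMeasure (E := EuclideanSpace ℝ (Fin 3)) (δ := δ)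
  have hE := measurableEmbedding_toMeasure (EuclideanSpace ℝ (Fin 3)) (δ := δ)
  -- D1: pull back to the configuration space
  obtain ⟨Q, hQ, hQmap⟩ := exists_map_toMeasure_eq (δ := δ) hcore
  haveI := hQ
  -- D0: Campbell invariance of `Q`
  have hstatQ : IsPointStationaryLaw (Q.map fun S : RootedHardCoreConfig (EuclideanSpace ℝ (Fin 3)) δ =>
      (S.1 : LocalConfig (EuclideanSpace ℝ (Fin 3))).toMeasure) := by
    rw [hQmap]; exact hstat
  have hinvQ := map_reroot_compProd_eq_of_isPointStationaryLaw hstatQ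
  -- D2: the invariant σ-algebra
  obtain ⟨m, hmle, hmiff⟩ := exists_invariant_measurableSpace (E := EuclideanSpace ℝ (Fin 3)) (δ := δ)
    (m₀ := Subtype.instMeasurableSpace)
  letI instX : MeasurableSpace (RootedHardCoreConfig (EuclideanSpace ℝ (Fin 3)) δ) :=
    Subtype.instMeasurableSpace
  let 𝓘 : {m' : MeasurableSpace (RootedHardCoreConfig (EuclideanSpace ℝ (Fin 3)) δ) //
      m' ≤ (Subtype.instMeasurableSpace :
        MeasurableSpace (RootedHardCoreConfig (EuclideanSpace ℝ (Fin 3)) δ))} := ⟨m, hmle⟩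
  -- D3: a.e. Campbell invariance of the conditional laws (through restriction to invariant events)
  have hres := fun (A : Set (RootedHardCoreConfig (EuclideanSpace ℝ (Fin 3)) δ))
      (hA : MeasurableSet[m] A) =>
    map_reroot_compProd_restrict hinvQ ((hmiff A).1 hA).1 ((hmiff A).1 hA).2
  have haeinv := ae_map_reroot_compProd_condExpKernel (Q := Q) 𝓘 hres
  -- D5 (hypothesis): a.e. ergodicity
  have haeerg := hErg δ hδ Q hinvQ 𝓘 hmiff
  -- D6: the kernel
  have hκm : Measurable (fun ω => (condExpKernel Q m ω :
      Measure (RootedHardCoreConfig (EuclideanSpace ℝ (Fin 3)) δ))) :=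
    (condExpKernel Q m).measurable.mono hmle le_rfl
  have hF : Measurable (fun ω => (condExpKernel Q m ω).map
      fun S : RootedHardCoreConfig (EuclideanSpace ℝ (Fin 3)) δ =>
        (S.1 : LocalConfig (EuclideanSpace ℝ (Fin 3))).toMeasure) :=
    (Measure.measurable_map _ hE.measurable).comp hκm
  have hQbind : Q.bind (fun ω => (condExpKernel Q m ω :
      Measure (RootedHardCoreConfig (EuclideanSpace ℝ (Fin 3)) δ))) = Q := by
    have h := restrict_eq_bind_condExpKernel (Q := Q) hmle (@MeasurableSet.univ _ m)
    rw [Measure.restrict_univ] at h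
    exact h.symm
  refine ⟨Q, hQ, fun ω => (condExpKernel Q m ω).map
      fun S : RootedHardCoreConfig (EuclideanSpace ℝ (Fin 3)) δ =>
        (S.1 : LocalConfig (EuclideanSpace ℝ (Fin 3))).toMeasure, hF, ?_, ?_⟩
  · -- `Q.bind F = P`
    refine Measure.ext fun s hs => ?_
    rw [Measure.bind_apply hs hF.aemeasurable, ← hQmap, Measure.map_apply hE.measurable hs]
    conv_rhs => rw [← hQbind]
    rw [Measure.bind_apply (hE.measurable hs) hκm.aemeasurable]
    refine lintegral_congr fun ω => ?_
    rw [Measure.map_apply hE.measurable hs]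
  · -- almost every component is a point-stationary ergodic probability law
    filter_upwards [haeinv, haeerg] with ω hinvω hergω
    exact ⟨Measure.isProbabilityMeasure_map hE.measurable.aemeasurable,
      isPointStationaryLaw_map_toMeasure hinvω, ergodic_map_toMeasure hergω⟩


/-- **`stub_ergodicReduction` modulo a.e. ergodicity.**  The registered statement `S_ergodicReduction` of
`stub_ergodicReduction` (crux `AperiodicFrustratedLawGap`, skeleton `dd3251ad731e`) VERBATIM, from exactly
two named inputs: `hLB` = the energy lower bound of item 9229 (`UnimodularEnergyLowerBound`, PROVED in the
tree by `Summit.AtomisticToContinuum.Crystallization.Theorems.unimodularEnergyLowerBound_proof`) and `hErg` =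
a.e. ergodicity of the conditional laws given the re-rooting-invariant σ-algebra (step D5 of the plan, the
one open input).  Composition of `kernelDecomposition_of_aeErgodic` with
`ergodicReduction_of_kernelDecomposition`. [folklore] -/
theorem ergodicReduction_of_aeErgodic (hLB : UnimodularEnergyLowerBound)
    (hErg : ∀ δ : ℝ, ∀ hδ : 0 < δ, ∀ (Q : MeasureTheory.Measure (Literature.Probability.Process.LocalConfig.RootedHardCoreConfig (EuclideanSpace ℝ (Fin 3)) δ)) [MeasureTheory.IsProbabilityMeasure Q], haveI : Fact (0 < δ) := ⟨hδ⟩; (haveI := Summit.AtomisticToContinuum.Crystallization.Theorems.BenjaminiSchrammLimit.isSFiniteKernel_toMeasure (E := EuclideanSpace ℝ (Fin 3)) (δ := δ); (Q ⊗ₘ (⟨fun S : Literature.Probability.Process.LocalConfig.RootedHardCoreConfig (EuclideanSpace ℝ (Fin 3)) δ => (S.1 : Literature.Probability.Process.LocalConfig (EuclideanSpace ℝ (Fin 3))).toMeasure, Literature.Probability.Process.LocalConfig.measurable_toMeasure (Fact.out : 0 < δ)⟩ : ProbabilityTheory.Kernel (Literature.Probability.Process.LocalConfig.RootedHardCoreConfig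 (EuclideanSpace ℝ (Fin 3)) δ) (EuclideanSpace ℝ (Fin 3)))).map (fun p : Literature.Probability.Process.LocalConfig.RootedHardCoreConfig (EuclideanSpace ℝ (Fin 3)) δ × EuclideanSpace ℝ (Fin 3) => ((if h : p.2 ∈ ((p.1.1 : Literature.Probability.Process.LocalConfig (EuclideanSpace ℝ (Fin 3))) : Set (EuclideanSpace ℝ (Fin 3))) then p.1.reroot p.2 h else p.1 : Literature.Probability.Process.LocalConfig.RootedHardCoreConfig (EuclideanSpace ℝ (Fin 3)) δ), -p.2)) = Q ⊗ₘ (⟨fun S : Literature.Probability.Process.LocalConfig.RootedHardCoreConfig (EuclideanSpace ℝ (Fin 3)) δ => (S.1 : Literature.Probability.Process.LocalConfig (EuclideanSpace ℝ (Fin 3))).toMeasure, Literature.Probability.Process.LocalConfig.measurable_toMeasure (Fact.out : 0 < δ)⟩ : ProbabilityTheory.Kernel (Literature.Probability.Process.LocalConfig.RootedHardCoreConfig (EuclideanSpace ℝ (Fin 3)) δ) (EuclideanSpace ℝ (Fin 3)))) → ∀ 𝓘 : {m : MeasurableSpace (Literature.Probability.Process.LocalConfig.RootedHardCoreConfig (EuclideanSpace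 ℝ (Fin 3)) δ) // m ≤ (Subtype.instMeasurableSpace : MeasurableSpace (Literature.Probability.Process.LocalConfig.RootedHardCoreConfig (EuclideanSpace ℝ (Fin 3)) δ))}, (∀ B : Set (Literature.Probability.Process.LocalConfig.RootedHardCoreConfig (EuclideanSpace ℝ (Fin 3)) δ), MeasurableSet[𝓘.1] B ↔ (MeasurableSet B ∧ (∀ (S : Literature.Probability.Process.LocalConfig.RootedHardCoreConfig (EuclideanSpace ℝ (Fin 3)) δ) (y : EuclideanSpace ℝ (Fin 3)) (hy : y ∈ ((S.1 : Literature.Probability.Process.LocalConfig (EuclideanSpace ℝ (Fin 3))) : Set (EuclideanSpace ℝ (Fin 3)))), S ∈ B ↔ S.reroot y hy ∈ B))) → ∀ᵐ ω ∂Q, ∀ B : Set (Literature.Probability.Process.LocalConfig.RootedHardCoreConfig (EuclideanSpace ℝ (Fin 3)) δ), MeasurableSet B → (∀ (S : Literature.Probability.Process.LocalConfig.RootedHardCoreConfig (EuclideanSpace ℝ (Fin 3)) δ) (y : EuclideanSpace ℝ (Fin 3)) (hy : y ∈ ((S.1 : Literature.Probability.Process.LocalConfig (EuclideanSpace ℝ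 (Fin 3))) : Set (EuclideanSpace ℝ (Fin 3)))), S ∈ B ↔ S.reroot y hy ∈ B) → ProbabilityTheory.condExpKernel Q 𝓘.1 ω B = 0 ∨ ProbabilityTheory.condExpKernel Q 𝓘.1 ω Bᶜ = 0) :
    ∀ δ : ℝ, 0 < δ → ∀ P : MeasureTheory.Measure (MeasureTheory.Measure (EuclideanSpace ℝ (Fin 3))), let Gy : ℝ → (N : ℕ) → (Fin N → EuclideanSpace ℝ (Fin 3)) → Fin N → Prop := fun η N y j => let d : ℝ := sInf ((fun z => dist z (y (j : Fin N))) '' (Set.range (y) \ {(y (j : Fin N))})); let T : Set (EuclideanSpace ℝ (Fin 3)) := {z : EuclideanSpace ℝ (Fin 3) | z ∈ Set.range (y) ∧ z ≠ (y (j : Fin N)) ∧ dist z (y (j : Fin N)) < 13 / 10 * d}; ∃ A : EuclideanSpace ℝ (Fin 3) →ₗᵢ[ℝ] EuclideanSpace ℝ (Fin 3), (∃ e : ↥T ≃ ↥Literature.Geometry.DiscreteGeometry.fccKissingPattern, ∀ t : ↥T, dist (d⁻¹ • ((t : EuclideanSpace ℝ (Fin 3)) - (y (j : Fin N)))) (A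 ((e t : ↥Literature.Geometry.DiscreteGeometry.fccKissingPattern) : EuclideanSpace ℝ (Fin 3))) ≤ η) ∨ (∃ e : ↥T ≃ ↥Literature.Geometry.DiscreteGeometry.hcpKissingPattern, ∀ t : ↥T, dist (d⁻¹ • ((t : EuclideanSpace ℝ (Fin 3)) - (y (j : Fin N)))) (A ((e t : ↥Literature.Geometry.DiscreteGeometry.hcpKissingPattern) : EuclideanSpace ℝ (Fin 3))) ≤ η); let TexBall : (N : ℕ) → (Fin N → EuclideanSpace ℝ (Fin 3)) → Fin N → ℝ → ℝ → ℝ → ℝ → Prop := fun N y i R R₇ R₈ R₉ => (∀ a b : Fin N, a ≠ b → (7 : ℝ) / 10 ≤ dist (y a) (y b)) ∧ (∀ j : Fin N, dist (y j) (y i) ≤ R → ¬ Gy (1 / 20) N (y) j) ∧ (∀ j : Fin N, dist (y j) (y i) ≤ R → ¬ ((∀ j' : Fin N, dist (y j') (y j) ≤ R₇ → ¬ Gy (1 / 20) N (y) j') ∧ (∀ z : EuclideanSpace ℝ (Fin 3), dist z (y j) ≤ R₇ → ∃ k : Fin N, dist z (y k) ≤ 1) ∧ (∀ j' : Fin N,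 dist (y j') (y j) ≤ R₇ → (let d : ℝ := sInf ((fun z => dist z (y j')) '' (Set.range (y) \ {(y j')})); ∀ k : Fin N, y k ≠ y j' → dist (y k) (y j') < 27 / 20 * d → 5 ≤ Nat.card {m : Fin N // y m ≠ y j' ∧ dist (y m) (y j') < 27 / 20 * d ∧ y m ≠ y k ∧ dist (y m) (y k) < 27 / 20 * d})))) ∧ (∀ j : Fin N, dist (y j) (y i) ≤ R → ∃ k : Fin N, dist (y k) (y j) ≤ R₈ ∧ Gy (1 / 8) N (y) k) ∧ (∀ j : Fin N, dist (y j) (y i) ≤ R → ¬ ((∀ j' : Fin N, dist (y j') (y j) ≤ R₉ → ¬ Gy (1 / 20) N (y) j') ∧ (Nat.card {j' : Fin N // dist (y j') (y j) ≤ R₉ ∧ ¬ Gy (1 / 8) N (y) j'} : ℝ) ≤ 1 / 2 * (Nat.card {j' : Fin N // dist (y j') (y j) ≤ R₉} : ℝ) ∧ (∀ j' : Fin N, dist (y j') (y j) ≤ R₉ → ¬ Gy (1 / 8) N (y) j' → ¬ (let d : ℝ := sInf ((fun z => dist z (y j')) '' (Set.range (y) \ {(y j')})); ∀ k : Fin N,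 y k ≠ y j' → dist (y k) (y j') < 27 / 20 * d → 5 ≤ Nat.card {m : Fin N // y m ≠ y j' ∧ dist (y m) (y j') < 27 / 20 * d ∧ y m ≠ y k ∧ dist (y m) (y k) < 27 / 20 * d})))); let Appr : MeasureTheory.Measure (EuclideanSpace ℝ (Fin 3)) → ℝ → ℝ → ℝ → Prop := fun μ R₇ R₈ R₉ => ∀ q : EuclideanSpace ℝ (Fin 3), μ {q} ≠ 0 → ∀ R ε : ℝ, 0 < ε → ∃ (N : ℕ) (y : Fin N → EuclideanSpace ℝ (Fin 3)) (i : Fin N), TexBall N y i R R₇ R₈ R₉ ∧ (∀ p : EuclideanSpace ℝ (Fin 3), μ {p} ≠ 0 → dist p q ≤ R → ∃ k : Fin N, dist (y k - y i) (p - q) ≤ ε) ∧ (∀ k : Fin N, dist (y k) (y i) ≤ R → ∃ p : EuclideanSpace ℝ (Fin 3), μ {p} ≠ 0 ∧ dist (y k - y i) (p - q) ≤ ε); MeasureTheory.IsProbabilityMeasure P → (∀ᵐ μ ∂P, Literature.Probability.Process.IsRootedHardCore δ μ) → Literature.Probability.Process.IsPointStationaryLaw P → (∃ R₇ R₈ R₉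 : ℝ, ∀ᵐ μ ∂P, Appr μ R₇ R₈ R₉) → (∀ᵐ μ ∂P, ∀ p : EuclideanSpace ℝ (Fin 3), μ {p} ≠ 0 → ∀ y : EuclideanSpace ℝ (Fin 3), (∀ q : EuclideanSpace ℝ (Fin 3), μ {q} ≠ 0 → q ≠ p → y ≠ q) → ∑' q : {q : EuclideanSpace ℝ (Fin 3) // μ {q} ≠ 0 ∧ q ≠ p}, Literature.MathematicalPhysics.StatisticalMechanics.lennardJones (dist p (q : EuclideanSpace ℝ (Fin 3))) ≤ ∑' q : {q : EuclideanSpace ℝ (Fin 3) // μ {q} ≠ 0 ∧ q ≠ p}, Literature.MathematicalPhysics.StatisticalMechanics.lennardJones (dist y (q : EuclideanSpace ℝ (Fin 3)))) → P {μ : MeasureTheory.Measure (EuclideanSpace ℝ (Fin 3)) | ∃ Q : Literature.MathematicalPhysics.StatisticalMechanics.PeriodicConfiguration 3, ∃ t : EuclideanSpace ℝ (Fin 3), {p : EuclideanSpace ℝ (Fin 3) | μ {p} ≠ 0} = (fun s => s + t) '' Q.points} = 0 → (∫ μ, Literature.MathematicalPhysics.StatisticalMechanics.rootEnergy Literature.MathematicalPhysics.StatisticalMechanics.lennardJones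 μ ∂P) ≤ (⨅ Q : Literature.MathematicalPhysics.StatisticalMechanics.PeriodicConfiguration 3, Q.energyPerParticle Literature.MathematicalPhysics.StatisticalMechanics.lennardJones) → ∃ P' : MeasureTheory.Measure (MeasureTheory.Measure (EuclideanSpace ℝ (Fin 3))), MeasureTheory.IsProbabilityMeasure P' ∧ (∀ᵐ μ ∂P', Literature.Probability.Process.IsRootedHardCore δ μ) ∧ Literature.Probability.Process.IsPointStationaryLaw P' ∧ (∃ R₇ R₈ R₉ : ℝ, ∀ᵐ μ ∂P', Appr μ R₇ R₈ R₉) ∧ (∀ᵐ μ ∂P', ∀ p : EuclideanSpace ℝ (Fin 3), μ {p} ≠ 0 → ∀ y : EuclideanSpace ℝ (Fin 3), (∀ q : EuclideanSpace ℝ (Fin 3), μ {q} ≠ 0 → q ≠ p → y ≠ q) → ∑' q : {q : EuclideanSpace ℝ (Fin 3) // μ {q} ≠ 0 ∧ q ≠ p}, Literature.MathematicalPhysics.StatisticalMechanics.lennardJones (dist p (q : EuclideanSpace ℝ (Fin 3))) ≤ ∑' q : {q : EuclideanSpace ℝ (Fin 3) // μ {q} ≠ 0 ∧ q ≠ p},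 Literature.MathematicalPhysics.StatisticalMechanics.lennardJones (dist y (q : EuclideanSpace ℝ (Fin 3)))) ∧ P' {μ : MeasureTheory.Measure (EuclideanSpace ℝ (Fin 3)) | ∃ Q : Literature.MathematicalPhysics.StatisticalMechanics.PeriodicConfiguration 3, ∃ t : EuclideanSpace ℝ (Fin 3), {p : EuclideanSpace ℝ (Fin 3) | μ {p} ≠ 0} = (fun s => s + t) '' Q.points} = 0 ∧ (∫ μ, Literature.MathematicalPhysics.StatisticalMechanics.rootEnergy Literature.MathematicalPhysics.StatisticalMechanics.lennardJones μ ∂P') ≤ (⨅ Q : Literature.MathematicalPhysics.StatisticalMechanics.PeriodicConfiguration 3, Q.energyPerParticle Literature.MathematicalPhysics.StatisticalMechanics.lennardJones) ∧ (∀ A : Set (MeasureTheory.Measure (EuclideanSpace ℝ (Fin 3))), MeasurableSet A → (∀ μ : MeasureTheory.Measure (EuclideanSpace ℝ (Fin 3)), ∀ p : EuclideanSpace ℝ (Fin 3), μ {p} ≠ 0 → (μ ∈ A ↔ MeasureTheory.Measure.map (fun z : EuclideanSpace ℝ (Fin 3) => z - p) μ ∈ A)) → P' A = 0 ∨ P'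 Aᶜ = 0) :=
  ergodicReduction_of_kernelDecomposition hLB (kernelDecomposition_of_aeErgodic hErg)

end Summit.AtomisticToContinuum.Crystallization.Theorems.FrustratedLawDichotomyErgodicReduction

end
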